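import Literature.AlgebraicGeometry.Resolution.PermissibleNuEliminationInDim
import Literature.AlgebraicGeometry.Resolution.HilbertSamuelPermissibleConverseDim
import Literature.AlgebraicGeometry.Resolution.SubschemeRegularStalks
import Literature.AlgebraicGeometry.Resolution.StalkSpecializesLocalization
import Literature.AlgebraicGeometry.Resolution.StalkIdealGenerization
import Literature.AlgebraicGeometry.Resolution.HilbertSamuelLowerBound
import Literature.AlgebraicGeometry.Resolution.HilbertSamuelGenericConstancyExcellent
import Literature.AlgebraicGeometry.Resolution.SigmaMaxEliminationInDim
import Literature.AlgebraicGeometry.Resolution.BlowupReducedDimension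
import HarnessLib

/-!
# Route `HilbertSamuelElimination`, crux `SigmaMaxModificationsCorridor3`
# (stmt-ResolutionOfSingularities-19249; child of `SigmaMaxModifications` stmt-…-18506),
# line `tame_wild` v3 — REGULAR CENTRES INSIDE A HILBERT–SAMUEL STRATUM ARE PERMISSIBLE

[OURS · L1 W4.2] Bookkeeping brick for the CONFINEMENT stub `stub_confine3` of skeleton v3 (and
for the first rung FC-R1 of the card `fibral-confinement`, CHAIN w42 §4 row stub-3): every
construction of a confining blow-up sequence produces its centres as REGULAR closed subschemes
lying in the successive `ν`-strata (`s.AllRegular ∧ s.CentresInStratum N ν`), whereas the stub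
states its output as `s.AllRegular ∧ s.CentresOver (Y(ν)) ∧ H^N non-increasing along s.comp`.
This file proves, once and for all, that the former implies the latter:

* `isPermissibleAt_of_isRegularLocalRing_quotient_stalkIdeal`,
  `isPermissible_of_isRegular_subscheme_of_support_subset_hsStratum` — **a closed subscheme
  `V(D)` which is regular and contained in a Hilbert–Samuel stratum `Y(ν)` is a permissible centre**
  (CJS Def. 3.1 (2)) at every point `x` with `𝒪_{Y,x}` catenary and `ψ_Y(x) ≤ N`, provided `V(D)`
  passes through no generic point of `Y`: Bennett's numerical criterion CJS Thm. 3.3 (3) ⇒ (1)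
  (tree: `Scheme.isNormallyFlat_of_hsFun_eq_of_ringKrullDim_eq`, every centre dimension) applied to
  the generisation `y ⤳ x` of the prime `D_x ⊆ 𝒪_{Y,x}` (regular quotient ⇒ prime), which lies in
  `V(D) ⊆ Y(ν)` so that `H_Y(x) = ν = H_Y(y)`.
* `hsFun_eq_iterPSum_Phi_of_maximalIdeal_mem_minimalPrimes`,
  `maximalIdeal_not_mem_minimalPrimes_of_mem_hsStratum` — on a REDUCED scheme the generic points
  have the regular value `Φ^{(N)}`, so a stratum `Y(ν)` with `ν ≠ Φ^{(N)}` contains none of them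
  (the proviso above is automatic).
* `CentreSeq.allPermissible_of_allRegular_of_centresInStratum` — **along a blow-up sequence**
  `s : CentreSeq Y` of a reduced excellent locally Noetherian `Y` with `dim Y ≤ N` and
  `ν ≠ Φ^{(N)}`: regular centres in the successive strata `Y_i(ν)` are permissible (the blown-up
  schemes stay reduced, excellent, of dimension `≤ N`: CJS Thm. 6.6, Stacks 02ND).
* `CentreSeq.hsFun_comp_le_of_allRegular_of_centresInStratum`,
  `CentreSeq.centresOver_hsStratum_of_allRegular_of_centresInStratum`,
  `CentreSeq.confinementClauses_of_allRegular_of_centresInStratum` — hence `H^N` does not increase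
  along `s.comp` (Bennett–Hironaka–Singh, CJS Thm. 3.10 (1), PROVED in the tree:
  `CossartJannsenSaito2020_thm_3_10_1_holds`) and, for `ν` maximal, the centres lie over `Y(ν)` —
  exactly the hypotheses `hreg`, `hover`, `hmono` of `stub_confinedTameNu3_of_thor4` /
  `stub_confinedWildNu3` and the conclusion clauses of `stub_confine3`.

NOT a statement of any manuscript; AI-written bookkeeping, weaker than expert review.

## Sources

* V. Cossart, U. Jannsen, S. Saito, *Desingularization: Invariants and Strategy*, LNM 2270
  (2020), Def. 2.28, Lemma 2.31, Def. 3.1, Thm. 3.3, Thm. 3.10 (1), Thm. 6.6, Def. 6.14.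
  [CossartJannsenSaito2020]
* M. Herrmann, S. Ikeda, U. Orbanz, *Equimultiplicity and Blowing up* (1988), Thm. (22.24).
  [HerrmannIkedaOrbanz1988]
* The Stacks Project, Tags 01J7 (points of `Spec 𝒪_{X,x}`), 02ND (blow-ups). [StacksProject]
-/

set_option linter.dupNamespace false -- mandated namespace of this single-conjunct summit

noncomputable section

open CategoryTheory AlgebraicGeometry TopologicalSpace Topology IsLocalRing
open Literature.AlgebraicGeometry.Resolution Literature.RingTheory.HilbertSamuel

namespace Summit.ResolutionOfSingularities.ResolutionOfSingularities.Theorems.SigmaMaxModificationsCorridor3.Helpers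

universe u

/-! ## Generic points of a reduced scheme carry the regular value -/

/-- In a reduced local ring whose maximal ideal is a minimal prime, the maximal ideal is zero
(it is the only minimal prime, and the minimal primes intersect in the nilradical). [folklore] -/
theorem maximalIdeal_eq_bot_of_mem_minimalPrimes {R : Type*} [CommRing R] [IsLocalRing R]
    [IsReduced R] (h : maximalIdeal R ∈ minimalPrimes R) : maximalIdeal R = ⊥ := by
  have hall : ∀ p ∈ minimalPrimes R, p = maximalIdeal R := fun p hp =>
    le_antisymm (le_maximalIdeal hp.1.1.ne_top) (h.2 ⟨hp.1.1, bot_le⟩ (le_maximalIdeal hp.1.1.ne_top))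
  have hinf : sInf (minimalPrimes R) = maximalIdeal R := by
    apply le_antisymm
    · exact sInf_le h
    · exact le_sInf fun p hp => (hall p hp).ge
  have hnil : sInf (minimalPrimes R) = (⊥ : Ideal R) := by
    rw [minimalPrimes, Ideal.sInf_minimalPrimes]
    exact nilradical_eq_zero R
  rw [← hinf, hnil]

/-- **A generic point of a reduced locally Noetherian scheme has `H^N = Φ^{(N)}`**: its local
ring is a field (reduced of dimension zero), in particular regular of dimension `0 ≤ N`
(CJS Lemma 2.31). [cite: CossartJannsenSaito2020, Lemma 2.31] -/
theorem hsFun_eq_iterPSum_Phi_of_maximalIdeal_mem_minimalPrimes {Y : Scheme.{u}}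
    [IsLocallyNoetherian Y] [IsReduced Y] (N : ℕ) {y : Y}
    (hy : maximalIdeal (Y.presheaf.stalk y) ∈ minimalPrimes (Y.presheaf.stalk y)) :
    Scheme.hsFun Y N y = iterPSum N Phi := by
  have hbot : maximalIdeal (Y.presheaf.stalk y) = ⊥ := maximalIdeal_eq_bot_of_mem_minimalPrimes hy
  have hF : IsField (Y.presheaf.stalk y) := (IsLocalRing.isField_iff_maximalIdeal_eq).mpr hbot
  letI := hF.toField
  have hreg : y ∈ Scheme.regularLocus Y := by
    show IsRegularLocalRing (Y.presheaf.stalk y)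
    infer_instance
  have hdim : ringKrullDim (Y.presheaf.stalk y) = (0 : ℕ) := by
    rw [Nat.cast_zero]
    exact ringKrullDim_eq_zero_of_isField hF
  exact Scheme.hsFun_of_mem_regularLocus hreg hdim (Nat.zero_le N)

/-- Hence **a stratum `Y(ν)` with `ν ≠ Φ^{(N)}` of a reduced scheme contains no generic point**:
at its points the maximal ideal of the local ring is not a minimal prime.
[cite: CossartJannsenSaito2020, Lemma 2.31] -/
theorem maximalIdeal_not_mem_minimalPrimes_of_mem_hsStratum {Y : Scheme.{u}}
    [IsLocallyNoetherian Y] [IsReduced Y] {N : ℕ} {ν : ℕ → ℕ} (hν : ν ≠ iterPSum N Phi) {y : Y}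
    (hy : y ∈ Scheme.hsStratum Y N ν) :
    maximalIdeal (Y.presheaf.stalk y) ∉ minimalPrimes (Y.presheaf.stalk y) := fun h =>
  hν ((Scheme.mem_hsStratum_iff.mp hy).symm.trans
    (hsFun_eq_iterPSum_Phi_of_maximalIdeal_mem_minimalPrimes N h))

/-! ## A regular closed subscheme inside a stratum is a permissible centre -/

/-- **CJS Def. 3.1 (2) via Thm. 3.3 for an arbitrary regular centre, pointwise.** Let `Y` be
locally Noetherian, `V(D) ⊆ Y(ν)` a closed subscheme passing through no generic point of `Y`,
and `x ∈ V(D)` a point with `𝒪_{Y,x}` catenary, `ψ_Y(x) ≤ N` and `𝒪_{Y,x}/D_x` a regular local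
ring. Then `V(D)` is permissible at `x`: `D_x` is a prime (its quotient is a domain), its
generisation `y ⤳ x` lies in `V(D) ⊆ Y(ν)`, so `H_Y(x) = ν = H_Y(y)` and Bennett's criterion
(Thm. 3.3 (3) ⇒ (1), `Scheme.isNormallyFlat_of_hsFun_eq_of_ringKrullDim_eq`) gives normal
flatness; `D_x` is not a minimal prime because `y` is not a generic point.
[cite: CossartJannsenSaito2020, Def. 3.1 (2), Thm. 3.3] [cite: HerrmannIkedaOrbanz1988, Thm. (22.24)] -/
theorem isPermissibleAt_of_isRegularLocalRing_quotient_stalkIdeal {Y : Scheme.{u}}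
    [IsLocallyNoetherian Y] (N : ℕ) (ν : ℕ → ℕ) (D : Y.IdealSheafData)
    (hD : (D.support : Set Y) ⊆ Scheme.hsStratum Y N ν)
    (hgen : ∀ y ∈ (D.support : Set Y),
      maximalIdeal (Y.presheaf.stalk y) ∉ minimalPrimes (Y.presheaf.stalk y))
    {x : Y} (hx : x ∈ (D.support : Set Y)) (hcat : IsCatenaryRing (Y.presheaf.stalk x))
    (hN : Scheme.hsPsi Y x ≤ N)
    (hreg : IsRegularLocalRing (Y.presheaf.stalk x ⧸ stalkIdeal D x)) :
    IdealSheafData.IsPermissibleAt D x := by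
  -- the stalk ideal is prime: its quotient is a regular local ring, hence a domain
  haveI : IsDomain (Y.presheaf.stalk x ⧸ stalkIdeal D x) := isDomain_of_isRegularLocalRing _
  haveI hprime : (stalkIdeal D x).IsPrime :=
    (Ideal.Quotient.isDomain_iff_prime (stalkIdeal D x)).mp inferInstance
  -- its generisation `y ⤳ x` (Stacks 01J7)
  obtain ⟨y, h, hy⟩ := exists_specializes_comap_stalkSpecializes_eq x (stalkIdeal D x)
  have hy' : stalkIdeal D x = primeOfSpecializes h := hy
  have hyD : y ∈ (D.support : Set Y) :=
    (mem_support_iff_stalkIdeal_le_primeOfSpecializes h D).mpr hy'.le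
  have hH : Scheme.hsFun Y N x = Scheme.hsFun Y N y :=
    (Scheme.mem_hsStratum_iff.mp (hD hx)).trans (Scheme.mem_hsStratum_iff.mp (hD hyD)).symm
  -- `𝒪_{Y,x}/𝔭_y` is regular of some dimension `c`
  haveI hregy : IsRegularLocalRing (Y.presheaf.stalk x ⧸ primeOfSpecializes h) :=
    IsRegularLocalRing.of_ringEquiv (Ideal.quotEquivOfEq hy')
  obtain ⟨c, hc⟩ : ∃ c : ℕ, ringKrullDim (Y.presheaf.stalk x ⧸ primeOfSpecializes h) = c :=
    exists_nat_eq_of_ne_bot_of_ne_top ringKrullDim_ne_bot ringKrullDim_ne_top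
  -- Bennett: normal flatness from `H_Y(x) = H_Y(y)`
  have hNF : (primeOfSpecializes h).IsNormallyFlat :=
    Scheme.isNormallyFlat_of_hsFun_eq_of_ringKrullDim_eq N h hcat hc hN hH
  -- `𝔭_y` is not a minimal prime: `y` is not a generic point of `Y`
  have hmin : primeOfSpecializes h ∉ minimalPrimes (Y.presheaf.stalk x) := fun hm =>
    hgen y hyD ((primeOfSpecializes_mem_minimalPrimes_iff h).mp hm)
  haveI : (primeOfSpecializes h).IsPrime := Ideal.IsPrime.comap _
  rw [IdealSheafData.isPermissibleAt_iff, hy', Ideal.isPermissible_iff]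
  exact ⟨hregy, hNF, (not_le_minimalPrimes_iff_not_mem _).mpr hmin⟩

/-- **A regular closed subscheme contained in a Hilbert–Samuel stratum is a permissible centre**
(CJS Def. 3.1 (2) with Thm. 3.3): for `Y` locally Noetherian with catenary local rings and
`ψ_Y ≤ N` (e.g. `Y` excellent of dimension `≤ N`), an ideal sheaf `D` whose closed subscheme
`V(D)` is regular, lies in `Y(ν)`, and passes through no generic point of `Y`, is permissible.
This is how centres inside `X_max` are recognised as permissible in every line of this crux
(CJS Rem. 6.29; the tame transfer and the confinement of skeleton v3).
[cite: CossartJannsenSaito2020, Def. 3.1 (2), Thm. 3.3] -/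
theorem isPermissible_of_isRegular_subscheme_of_support_subset_hsStratum {Y : Scheme.{u}}
    [IsLocallyNoetherian Y] (N : ℕ) (ν : ℕ → ℕ)
    (hcat : ∀ x : Y, IsCatenaryRing (Y.presheaf.stalk x)) (hN : ∀ x : Y, Scheme.hsPsi Y x ≤ N)
    (D : Y.IdealSheafData) (hreg : Scheme.IsRegular D.subscheme)
    (hD : (D.support : Set Y) ⊆ Scheme.hsStratum Y N ν)
    (hgen : ∀ y ∈ (D.support : Set Y),
      maximalIdeal (Y.presheaf.stalk y) ∉ minimalPrimes (Y.presheaf.stalk y)) :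
    IdealSheafData.IsPermissible D := fun x hx =>
  isPermissibleAt_of_isRegularLocalRing_quotient_stalkIdeal N ν D hD hgen hx (hcat x) (hN x)
    ((Scheme.isRegular_subscheme_iff D).mp hreg x hx)

/-- The same on a **reduced excellent scheme of dimension `≤ N`, for a stratum `ν ≠ Φ^{(N)}`**
(all provisos automatic: excellent ⇒ catenary local rings, `dim Y ≤ N ⇒ ψ_Y ≤ N`, and
`Y(ν) ∌` generic points by `maximalIdeal_not_mem_minimalPrimes_of_mem_hsStratum`).
[cite: CossartJannsenSaito2020, Def. 3.1 (2), Thm. 3.3, Lemma 2.31] -/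
theorem isPermissible_of_isRegular_subscheme_of_support_subset_hsStratum_of_isExcellent
    {Y : Scheme.{u}} [IsLocallyNoetherian Y] [IsReduced Y] (hexc : Scheme.IsExcellent Y) {N : ℕ}
    (hdim : topologicalKrullDim Y ≤ (N : WithBot ℕ∞)) {ν : ℕ → ℕ} (hν : ν ≠ iterPSum N Phi)
    (D : Y.IdealSheafData) (hreg : Scheme.IsRegular D.subscheme)
    (hD : (D.support : Set Y) ⊆ Scheme.hsStratum Y N ν) :
    IdealSheafData.IsPermissible D :=
  isPermissible_of_isRegular_subscheme_of_support_subset_hsStratum N ν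
    (Scheme.isCatenaryRing_stalk_of_isExcellent hexc) (Scheme.hsPsi_le_of_topologicalKrullDim_le hdim)
    D hreg hD fun _ hy => maximalIdeal_not_mem_minimalPrimes_of_mem_hsStratum hν (hD hy)

/-! ## Along a blow-up sequence: regular centres in the strata are permissible -/

/-- **Regular centres in the successive `ν`-strata of a blow-up sequence are permissible.** For
`Y` reduced, excellent, locally Noetherian with `dim Y ≤ N`, a value `ν ≠ Φ^{(N)}`, and
`s : CentreSeq Y` with all centres regular (`s.AllRegular`) and `D_i ⊆ Y_i(ν)`
(`s.CentresInStratum N ν`): all centres are permissible (`s.AllPermissible`). Induction along the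
sequence: each `Y_{i+1} = Bl_{D_i} Y_i` is again reduced (CJS Thm. 6.6), excellent (finite type
over `Y_i`) and of dimension `≤ N`. [cite: CossartJannsenSaito2020, Def. 3.1 (2), Thm. 3.3, Thm. 6.6, Def. 6.14] -/
theorem CentreSeq.allPermissible_of_allRegular_of_centresInStratum :
    ∀ {Y : Scheme.{u}} [IsLocallyNoetherian Y] [IsReduced Y] (s : CentreSeq Y) {N : ℕ} {ν : ℕ → ℕ},
      Scheme.IsExcellent Y → topologicalKrullDim Y ≤ (N : WithBot ℕ∞) → ν ≠ iterPSum N Phi →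
        s.AllRegular → s.CentresInStratum N ν → s.AllPermissible
  | _, _, _, CentreSeq.nil _, _, _, _, _, _, _, _ => trivial
  | Y, _, _, CentreSeq.cons C rest, N, ν, hexc, hdim, hν, hreg, hstr => by
    obtain ⟨hC, hrest⟩ := (CentreSeq.centresInStratum_cons C rest).mp hstr
    obtain ⟨hCreg, hrestreg⟩ := (CentreSeq.allRegular_cons C rest).mp hreg
    haveI : IsProper (blowup.π C) := (blowup.isBlowup C).isProper
    haveI : IsLocallyNoetherian (blowup C) := LocallyOfFiniteType.isLocallyNoetherian (blowup.π C)
    haveI : IsReduced (blowup C) := (blowup.isBlowup C).isReduced_of_isReduced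
    refine (CentreSeq.allPermissible_cons C rest).mpr ⟨?_, ?_⟩
    · exact isPermissible_of_isRegular_subscheme_of_support_subset_hsStratum_of_isExcellent hexc
        hdim hν C hCreg hC
    · exact CentreSeq.allPermissible_of_allRegular_of_centresInStratum rest
        (Scheme.IsExcellent.of_locallyOfFiniteType (blowup.π C) hexc)
        ((blowup.isBlowup C).topologicalKrullDim_le_of_isLocallyNoetherian hdim) hν hrestreg hrest

/-- **`H^N` does not increase along a blow-up sequence in regular centres inside the strata**
(Bennett–Hironaka–Singh, CJS Thm. 3.10 (1) — PROVED in the tree,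
`CossartJannsenSaito2020_thm_3_10_1_holds` — iterated over the permissible centres of
`CentreSeq.allPermissible_of_allRegular_of_centresInStratum`). This is the clause `hmono` of the
v3 stubs `stub_confine3` / `stub_confinedTameNu3_of_thor4` / `stub_confinedWildNu3`.
[cite: CossartJannsenSaito2020, Thm. 3.10 (1), Def. 6.14] -/
theorem CentreSeq.hsFun_comp_le_of_allRegular_of_centresInStratum {Y : Scheme.{u}}
    [IsLocallyNoetherian Y] [IsReduced Y] (s : CentreSeq Y) {N : ℕ} {ν : ℕ → ℕ}
    (hexc : Scheme.IsExcellent Y) (hdim : topologicalKrullDim Y ≤ (N : WithBot ℕ∞))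
    (hν : ν ≠ iterPSum N Phi) (hreg : s.AllRegular) (hstr : s.CentresInStratum N ν)
    (x' : s.top) : Scheme.hsFun s.top N x' ≤ Scheme.hsFun Y N (s.comp.base x') :=
  CentreSeq.hsFun_comp_le_of_allPermissible CossartJannsenSaito2020_thm_3_10_1_holds s
    (CentreSeq.allPermissible_of_allRegular_of_centresInStratum s hexc hdim hν hreg hstr) hexc hdim x'

/-- **The centres lie over the stratum `Y(ν)`** when `ν` is maximal in `Σ_Y(N)` (more generally
when no value lies strictly above `ν`): a point of `Y_i(ν)` maps to a point of value `≥ ν`, hence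
`= ν` (tree: `CentreSeq.centresOver_hsStratum_of_centresInStratum`). This is the clause `hover`
of the v3 stubs. [cite: CossartJannsenSaito2020, Def. 6.14, Thm. 3.10 (1)] -/
theorem CentreSeq.centresOver_hsStratum_of_allRegular_of_centresInStratum {Y : Scheme.{u}}
    [IsLocallyNoetherian Y] [IsReduced Y] (s : CentreSeq Y) {N : ℕ} {ν : ℕ → ℕ}
    (hexc : Scheme.IsExcellent Y) (hdim : topologicalKrullDim Y ≤ (N : WithBot ℕ∞))
    (hν : ν ≠ iterPSum N Phi) (hmax : Maximal (· ∈ Scheme.hsValues Y N) ν) (hreg : s.AllRegular)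
    (hstr : s.CentresInStratum N ν) : s.CentresOver (Scheme.hsStratum Y N ν) :=
  CentreSeq.centresOver_hsStratum_of_centresInStratum CossartJannsenSaito2020_thm_3_10_1_holds s
    (CentreSeq.allPermissible_of_allRegular_of_centresInStratum s hexc hdim hν hreg hstr) hexc hdim
    (fun _ hμ hle => hmax.2 hμ hle) hstr

/-- **The three confinement clauses at once** (shape of `stub_confine3`'s conclusion and of the
hypotheses `hreg`/`hover`/`hmono` of the transfer stubs of skeleton v3): a blow-up sequence of a
reduced excellent `Y`, `dim Y ≤ N`, with regular centres in the successive strata of a maximal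
value `ν ≠ Φ^{(N)}` has permissible centres, centres over `Y(ν)`, and `H^N` non-increasing along
its composite. [cite: CossartJannsenSaito2020, Def. 6.14, Thm. 3.3, Thm. 3.10 (1)] -/
theorem CentreSeq.confinementClauses_of_allRegular_of_centresInStratum {Y : Scheme.{u}}
    [IsLocallyNoetherian Y] [IsReduced Y] (s : CentreSeq Y) {N : ℕ} {ν : ℕ → ℕ}
    (hexc : Scheme.IsExcellent Y) (hdim : topologicalKrullDim Y ≤ (N : WithBot ℕ∞))
    (hν : ν ≠ iterPSum N Phi) (hmax : Maximal (· ∈ Scheme.hsValues Y N) ν) (hreg : s.AllRegular)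
    (hstr : s.CentresInStratum N ν) :
    s.AllPermissible ∧ s.CentresOver (Scheme.hsStratum Y N ν) ∧
      ∀ x' : s.top, Scheme.hsFun s.top N x' ≤ Scheme.hsFun Y N (s.comp.base x') :=
  ⟨CentreSeq.allPermissible_of_allRegular_of_centresInStratum s hexc hdim hν hreg hstr,
    CentreSeq.centresOver_hsStratum_of_allRegular_of_centresInStratum s hexc hdim hν hmax hreg hstr,
    CentreSeq.hsFun_comp_le_of_allRegular_of_centresInStratum s hexc hdim hν hreg hstr⟩

end Summit.ResolutionOfSingularities.ResolutionOfSingularities.Theorems.SigmaMaxModificationsCorridor3.Helpers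

end
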